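import Literature.AnabelianGeometry.SemiGraphs.Arithmetic
import Literature.AnabelianGeometry.SemiGraphs.ArithmeticDef51CondAClosures
import Literature.AnabelianGeometry.SemiGraphs.AmbientVocabDictionary
import Literature.AnabelianGeometry.SemiGraphs.SurfaceTypeStableGraphModels
import HarnessLib

/-!
# [SemiAnbd] Def. 5.1 (ii): the record `ArithSemiGraph` (connected arithmetic semi-graph of anabelioids)
# is inhabited — by the TRIVIAL arithmetic action, over any vocabulary and at the real vocabulary

Mochizuki, *Semi-graphs of anabelioids*, Publ. RIMS **42** (2006), §5, Definition 5.1 (i)/(ii), manuscript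
p. 62 [cite: MochizukiSemiAnbd2006, Def 5.1 (ii), p. 62]: a connected arithmetic semi-graph of anabelioids is
a triple `𝔊 = (𝔾, A, ρ_𝔾)` — `𝔾` a connected, coherent, totally aloof, verticially slim semi-graph of
anabelioids, `A` a slim connected anabelioid, `ρ_𝔾 : π̂₁(A) → Aut(𝔾)` a CONTINUOUS action, i.e. one for which
some open `H ⊆ π̂₁(A)` satisfies (a) `π̂₁(A)` topologically finitely generated, (b) `𝔾` locally finite,
(c) `H` acts trivially on the underlying semi-graph with continuous outer representations
`H → Out(π̂₁(𝔾_v))`, (d) finitely many `H`-isomorphism types of localizations `𝔾[v]`.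

Typed by abc-iut-L3-t3 as the record `ArithSemiGraph 𝓥` over the §§4–5 container `(𝓥 : SemiAnbdVocab Obj)`
(`Arithmetic.lean`).  The layer's inhabitation census (INHABITATION-CENSUS-L3 v2, abc-iut-w4-d098 g3) lists
`ArithSemiGraph` with 0 producers, and the two Example 5.6 producers landed since —
`StableReductionTower.nonempty_of_subsingleton` / `….exists_of_arithSemiGraph` (abc-iut-L3-t7,
`StableReductionTowerNonVacuity.lean`) — take exactly ONE remaining input: some `𝔊 : ArithSemiGraph 𝓥` with
trivial arithmetic fundamental group `π̂₁(A) = 1`.  This PROOF-ONLY file (abc-iut cell, block C / W6 seat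
abc-iut-w6-d117; no `def`, no `instance`, no named fact) supplies that input:

* `SemiAnbdVocab.isContinuousAction_one` — over ANY vocabulary `𝓥`: for an object `G` that is locally
  finite with finitely many vertices and on whose branches the identity arrow acts trivially (a law the
  container does not carry as a field; vacuous for edgeless `G`, `rfl` in toy vocabularies, true at the real
  vocabulary), the TRIVIAL action `ρ := 1` of any FINITE profinite group is continuous in the sense of
  Def 5.1 (i): `H := π̂₁(A)` itself, (a) finite groups are topologically finitely generated
  (`def51CondA_of_finite`), (c) the identity fixes everything and maps out of a finite discrete group are
  continuous, (d) `S :=` all vertices with the identity isomorphisms.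
* `ArithSemiGraph.exists_of_trivial_action` — hence every connected, coherent such `G` is the geometric
  component of an `ArithSemiGraph 𝓥` with `π̂₁(A) := 1` (the trivial profinite group is slim: it has no
  non-trivial open subgroup to centralise) and `ρ := 1`.
* `ArithSemiGraph.exists_ofReal_of_isCoherent` / `ArithSemiGraph.exists_ofReal` — AT THE REAL VOCABULARY
  `SemiAnbdVocab.ofReal R` (any bridge residual `R`): every coherent semi-graph of anabelioids of the ambient
  category with one vertex and no edges carries such a structure, and one EXISTS — abc-iut-L3-t1's
  Example 2.10 model `SemiGraphOfAnabelioids.exists_example_2_10_on` on the one-vertex edgeless semi-graph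
  (constituent anabelioid `B(Π_{0,3})`, a GENUINE coherent, verticially slim semi-graph of anabelioids).
  So the record is inhabited at the vocabulary the cone's statements are read in, with `π̂₁(A) = 1`,
  which is precisely the input named by abc-iut-L3-t7's tower producers.

HONEST LABEL: the arithmetic component here is the one-point anabelioid (`π̂₁(A) = 1`, the degenerate case
of "a slim connected anabelioid"); this is the legitimate but trivial instance of Def. 5.1 (ii), not the
arithmetic semi-graph of anabelioids of a pointed stable curve over a `p`-adic local field (Def. 5.1's
motivating case, Example 5.6), whose `π̂₁(A)` is an open subgroup of `G_K` — for that instance Def 5.1 (i)(a)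
needs the topological finite generation of `G_K` (GAP-LEDGER G-L4t4-2, [NSW] 7.5.10), not in the tree.
Instantiated ≠ endorsed; nothing here asserts a statement of [SemiAnbd]; nothing here bears on
[IUTchIII] Cor. 3.12.
-/

noncomputable section

namespace Literature.AnabelianGeometry.SemiGraphs

open _root_.CategoryTheory
open Literature.AlgebraicGeometry.Frobenioids (IsSlimGroup)

universe u v w v₁ u₁ u₂

/-! ### Folklore: the trivial profinite group -/

/-- A topological group with one element is slim (there is nothing to centralise). [folklore] -/
private theorem isSlimGroup_of_subsingleton (G : Type w) [Group G] [TopologicalSpace G]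
    [Subsingleton G] : IsSlimGroup G :=
  ⟨fun _ _ => Subsingleton.elim _ _⟩

/-! ### Def 5.1 (i): the trivial action of a finite group is continuous -/

section General

variable {Obj : Type u} [Category.{v} Obj] (𝓥 : SemiAnbdVocab.{u, v, w} Obj)

/-- **Def 5.1 (i) for the trivial action.**  Let `G` be locally finite ((b)) with finitely many vertices,
and assume the identity arrow acts trivially on branches.  Then the trivial action `ρ := 1` of any FINITE
profinite group `PA` on `G` is continuous: witness `H := PA`; (a) a finite group is topologically finitely
generated; (c) `ρ(h) = id` fixes every vertex and branch, and `H → Out(π̂₁(G_v))` is continuous because `H`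
is finite and discrete; (d) take `S :=` the (finite) set of all vertices and the identity isomorphisms
`G[w] ⥲ G[w]`. [cite: MochizukiSemiAnbd2006, Def 5.1 (i), p. 62] -/
theorem SemiAnbdVocab.isContinuousAction_one (G : Obj) (hlf : 𝓥.IsLocallyFinite G)
    [Finite (𝓥.Vert G)] (hbr : ∀ x : (Σ e : 𝓥.Edge G, 𝓥.Br e), 𝓥.mapTotalBr (𝟙 G) x = x)
    (PA : ProfiniteGrp.{w}) [Finite PA] :
    IsContinuousAction 𝓥 G PA (1 : PA →* Aut G) := by
  classical
  -- `ρ(h) = 1 = Iso.refl G`, whose underlying arrow is `𝟙 G`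
  have hhom : ∀ h : PA, ((1 : PA →* Aut G) h).hom = 𝟙 G := fun _ => rfl
  have hfixV : ∀ h ∈ (⊤ : OpenSubgroup PA), ∀ v : 𝓥.Vert G,
      𝓥.mapV ((1 : PA →* Aut G) h).hom v = v := by
    intro h _ v
    rw [hhom, 𝓥.mapV_id]
  have hC : Def51CondC 𝓥 G PA 1 ⊤ :=
    { fixesVert := hfixV
      fixesBr := fun h _ x => by rw [hhom]; exact hbr x
      continuous_outRep := fun _ => continuous_of_discreteTopology }
  refine ⟨⊤, { condA := def51CondA_of_finite PA, condB := hlf, condC := hC, condD := ?_ }⟩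
  refine ⟨Set.univ, Set.finite_univ, fun w => ⟨w, Set.mem_univ _, Iso.refl _, fun h hh => ?_⟩⟩
  simp

/-- **`ArithSemiGraph 𝓥` is inhabited by the trivial arithmetic action** (Def 5.1 (ii)): every connected,
coherent, locally finite object `G` with finitely many vertices (identity acting trivially on branches) is
the geometric component of a connected arithmetic semi-graph of anabelioids with `π̂₁(A) := 1` (the trivial
profinite group — slim, as it has no non-trivial open subgroup) and `ρ_𝔾 := 1`.  DEGENERATE arithmetic
component, honestly labelled. [cite: MochizukiSemiAnbd2006, Def 5.1 (ii), p. 62] -/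
theorem ArithSemiGraph.exists_of_trivial_action (G : Obj) (hconn : 𝓥.IsConnected G)
    (hcoh : 𝓥.IsCoherent G) (hlf : 𝓥.IsLocallyFinite G) [Finite (𝓥.Vert G)]
    (hbr : ∀ x : (Σ e : 𝓥.Edge G, 𝓥.Br e), 𝓥.mapTotalBr (𝟙 G) x = x) :
    ∃ 𝔊 : ArithSemiGraph 𝓥, 𝔊.G = G ∧ Subsingleton 𝔊.PA ∧ 𝔊.ρ = 1 :=
  ⟨{ G := G
     connected := hconn
     coherent := hcoh
     PA := ProfiniteGrp.of PUnit.{w + 1}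
     slim := isSlimGroup_of_subsingleton _
     ρ := 1
     continuous := 𝓥.isContinuousAction_one G hlf hbr _ }, rfl,
    inferInstanceAs (Subsingleton PUnit), rfl⟩

/-- The census form: `Nonempty (ArithSemiGraph 𝓥)` as soon as the vocabulary has one connected, coherent,
locally finite object with finitely many vertices on whose branches the identity acts trivially.
[cite: MochizukiSemiAnbd2006, Def 5.1 (ii), p. 62] -/
theorem ArithSemiGraph.nonempty_of_trivial_action (G : Obj) (hconn : 𝓥.IsConnected G)
    (hcoh : 𝓥.IsCoherent G) (hlf : 𝓥.IsLocallyFinite G) [Finite (𝓥.Vert G)]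
    (hbr : ∀ x : (Σ e : 𝓥.Edge G, 𝓥.Br e), 𝓥.mapTotalBr (𝟙 G) x = x) :
    Nonempty (ArithSemiGraph 𝓥) := by
  obtain ⟨𝔊, -⟩ := ArithSemiGraph.exists_of_trivial_action 𝓥 G hconn hcoh hlf hbr
  exact ⟨𝔊⟩

/-- An object with exactly one vertex and no edges is connected (§1 p.12: its topological realisation is
a point). [cite: MochizukiSemiAnbd2006, §2, p. 22] -/
theorem SemiAnbdVocab.isConnected_of_unique_of_isEmpty (G : Obj) [Unique (𝓥.Vert G)]
    [IsEmpty (𝓥.Edge G)] : 𝓥.IsConnected G := by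
  refine ⟨⟨Sum.inl default⟩, fun x y => ?_⟩
  obtain (x | x) := x
  · obtain (y | y) := y
    · rw [Unique.eq_default x, Unique.eq_default y]
      exact Relation.EqvGen.refl _
    · exact isEmptyElim y
  · exact isEmptyElim x

/-- An edgeless object is locally finite (no branch abuts anywhere). [cite: MochizukiSemiAnbd2006, §1, p. 13] -/
theorem SemiAnbdVocab.isLocallyFinite_of_isEmpty (G : Obj) [IsEmpty (𝓥.Edge G)] :
    𝓥.IsLocallyFinite G := fun _ =>
  Finite.of_injective (fun x : 𝓥.BrAt G _ => x.1.1) fun x => isEmptyElim x.1.1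

end General

/-! ### At the real vocabulary `SemiAnbdVocab.ofReal` -/

section Real

open SgAQuot SgAQuot.SgA SemiGraphOfAnabelioids
open Literature.GroupTheory.CombinatorialGroupTheory

/-- **At the real vocabulary**: every semi-graph of anabelioids of the ambient category (totally aloof,
verticially slim) which is COHERENT with exactly one vertex and no edges is the geometric component of a
connected arithmetic semi-graph of anabelioids over `SemiAnbdVocab.ofReal R` with `π̂₁(A) = 1`, `ρ = 1`
(conditions (b)–(d) of Def 5.1 (i) being vacuous or trivial on an edgeless one-vertex `𝔾`).
[cite: MochizukiSemiAnbd2006, Def 5.1 (ii), p. 62] -/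
theorem ArithSemiGraph.exists_ofReal_of_isCoherent (R : SgA.BridgeResidual.{v₁, u₁, u₂})
    (X : SgA.{v₁, u₁, u₂}) [Unique X.toSgA.graph.Vertex] [IsEmpty X.toSgA.graph.Edge]
    (hcoh : X.toSgA.IsCoherent) :
    ∃ 𝔊 : ArithSemiGraph (SemiAnbdVocab.ofReal R), 𝔊.G = X ∧ Subsingleton 𝔊.PA ∧ 𝔊.ρ = 1 := by
  haveI : Unique ((SemiAnbdVocab.ofReal R).Vert X) := inferInstanceAs (Unique X.toSgA.graph.Vertex)
  haveI : IsEmpty ((SemiAnbdVocab.ofReal R).Edge X) := inferInstanceAs (IsEmpty X.toSgA.graph.Edge)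
  exact ArithSemiGraph.exists_of_trivial_action (SemiAnbdVocab.ofReal R) X
    ((SemiAnbdVocab.ofReal R).isConnected_of_unique_of_isEmpty X) hcoh
    ((SemiAnbdVocab.ofReal R).isLocallyFinite_of_isEmpty X) (fun x => isEmptyElim x.1)

/-- **`ArithSemiGraph` is inhabited at the real vocabulary** `SemiAnbdVocab.ofReal R`, for every bridge
residual `R`: the geometric component is abc-iut-L3-t1's Example 2.10 model on the one-vertex, edgeless
semi-graph (one constituent anabelioid `B(Π_{0,3})`; a genuine coherent, totally elevated, verticially slim
semi-graph of anabelioids, `SemiGraphOfAnabelioids.exists_example_2_10_on`), the arithmetic component is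
the one-point anabelioid `π̂₁(A) = 1` with the trivial action.  This is the input named by
`StableReductionTower.exists_of_arithSemiGraph` (abc-iut-L3-t7). [cite: MochizukiSemiAnbd2006, Def 5.1 (ii), p. 62] -/
theorem ArithSemiGraph.exists_ofReal (R : SgA.BridgeResidual.{0, 1, 0}) :
    ∃ 𝔊 : ArithSemiGraph (SemiAnbdVocab.ofReal R), Subsingleton 𝔊.PA ∧ 𝔊.ρ = 1 ∧
      Nonempty (Unique ((SemiAnbdVocab.ofReal R).Vert 𝔊.G)) ∧
        IsEmpty ((SemiAnbdVocab.ofReal R).Edge 𝔊.G) := by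
  classical
  -- the one-vertex, edgeless semi-graph
  let 𝔾 : SemiGraph.{0} :=
    { Vertex := PUnit
      Edge := PEmpty
      Branch := PEmpty
      edgeOf := fun b => PEmpty.elim b
      abuts := fun b => PEmpty.elim b
      two_branches := fun e => PEmpty.elim e }
  have hE : ∀ e : 𝔾.Edge, ∃ v, 𝔾.EdgeAbuts e v := fun e => PEmpty.elim e
  -- Example 2.10 on it, with the hyperbolic type `(0, 3)` at the vertex (no cusp is a branch: `Star v = ∅`)
  obtain ⟨𝒢, hG, -, hcoh, -, -, -, hslim⟩ :=
    SemiGraphOfAnabelioids.exists_example_2_10_on {2} ⟨⟨2, rfl⟩, fun p hp => by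
        rw [Set.mem_singleton_iff] at hp; subst hp; exact Nat.prime_two⟩
      𝔾 hE (fun _ => 0) (fun _ => 3)
      (fun _ => by unfold PuncturedSurfaceGroup.IsHyperbolicType; omega)
      (fun _ b => PEmpty.elim b.1) (fun _ b => PEmpty.elim b.1)
  obtain ⟨graph, V, E, pull⟩ := 𝒢
  subst hG
  -- it is an object of the ambient category: totally aloof and "every edge abuts" are vacuous (no edges)
  let X : SgA.{0, 1, 0} :=
    ⟨⟨⟨⟨𝔾, V, E, pull⟩⟩⟩,
      ⟨⟨fun e => PEmpty.elim e⟩, hslim, fun e => PEmpty.elim e⟩⟩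
  haveI : Unique X.toSgA.graph.Vertex := inferInstanceAs (Unique PUnit)
  haveI : IsEmpty X.toSgA.graph.Edge := inferInstanceAs (IsEmpty PEmpty)
  obtain ⟨𝔊, hGX, hPA, hρ⟩ := ArithSemiGraph.exists_ofReal_of_isCoherent R X hcoh
  refine ⟨𝔊, hPA, hρ, ⟨?_⟩, ?_⟩
  · rw [hGX]; exact inferInstanceAs (Unique PUnit)
  · rw [hGX]; exact inferInstanceAs (IsEmpty PEmpty)

/-- The census form at the real vocabulary: `Nonempty (ArithSemiGraph (SemiAnbdVocab.ofReal R))`.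
[cite: MochizukiSemiAnbd2006, Def 5.1 (ii), p. 62] -/
theorem ArithSemiGraph.nonempty_ofReal (R : SgA.BridgeResidual.{0, 1, 0}) :
    Nonempty (ArithSemiGraph (SemiAnbdVocab.ofReal R)) := by
  obtain ⟨𝔊, -⟩ := ArithSemiGraph.exists_ofReal R
  exact ⟨𝔊⟩

/-- In particular (with abc-iut-w4-d082's degenerate residual `BridgeResidual.trivial`): the record
`ArithSemiGraph` has an inhabitant with trivial `π̂₁(A)` over an inhabited instance of the container at the
tree's own vocabulary — unconditionally. [cite: MochizukiSemiAnbd2006, Def 5.1 (ii), p. 62] -/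
theorem ArithSemiGraph.exists_ofReal_trivialResidual :
    ∃ 𝔊 : ArithSemiGraph (SemiAnbdVocab.ofReal SgA.BridgeResidual.trivial.{0, 1, 0}),
      Subsingleton 𝔊.PA ∧ 𝔊.ρ = 1 := by
  obtain ⟨𝔊, h1, h2, -⟩ := ArithSemiGraph.exists_ofReal SgA.BridgeResidual.trivial.{0, 1, 0}
  exact ⟨𝔊, h1, h2⟩

end Real

end Literature.AnabelianGeometry.SemiGraphs

end
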